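import Literature.Topology.FourManifolds.TracePolarTrace
import Literature.Topology.FourManifolds.BasinExtension
import HarnessLib

/-!
# Planarisation of the boundary off the trace circles: the flow map to the level sphere about
# the minimum

Topic `Literature/Topology/FourManifolds` (support for the Torelli half of Griffiths' handlebody
theorem, `stmt-SmoothPoincare4-15190`; first file of the Dehn/wave part).  Everything here is
**proved**; the definitions are explicit flow maps.

Milnor, *Lectures on the h-cobordism theorem* (1965), Def. 3.9 and Thm. 3.4 / 4.1: every point
of the basin of the minimum `p₀` of a gradient-like flow lies on a trajectory that crosses every
level between `g p₀` and its own, in particular the small round level sphere `{g = sphR}` of the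
radial Milnor chart at `p₀`.  For a basin setting `B` on a compact manifold with boundary `W` this
gives the **planarisation** of the boundary off the traces:

* `BasinSetting.planarDom B = ∂W ∖ traces` (`mem_planarDom_iff`);
* `BasinSetting.planar B y = toChart (levelProj θ sphR (push y))` — the point of the level sphere
  `{g = sphR}` (radius `rad` in the chart) on the trajectory of the boundary point `y`, read in
  the chart; smooth on the domain (`contMDiffAt_planar`), of norm `rad` (`norm_planar`);
* `BasinSetting.planarInv B v = bret (top (ofChart v))` — the inverse, defined on the chart sphere
  off the vectors whose ray does not reach `L` (the finitely many core directions, sequel);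
  `planarInv_planar`, `planar_planarInv`; injectivity of `planar` on the domain.

For a genus-`g` handlebody (`W` of dimension `3`) this identifies the planar surface
`∂W ∖ (belt circles)` with the `2`-sphere minus `2g` points — the stage on which the returning
arcs, waves and bigons of the Dehn/wave reduction live.

## References

* J. Milnor, *Lectures on the h-cobordism theorem* (1965), Def. 3.9, Thm. 3.4, Thm. 4.1
  (PDF pp. 12–13, 16, 22). [MilnorHCobordism1965]
* H. B. Griffiths, *Automorphisms of a 3-dimensional handlebody*, Abh. Math. Sem. Univ. Hamburg
  26 (1964), §3. [GriffithsHB1964Handlebody]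
-/

open scoped Manifold ContDiff Topology
open Set Function Filter Metric

noncomputable section

namespace Literature.Topology.FourManifolds

open Cobordism FourManifolds.Flow

universe u

namespace BasinSetting

variable {n : ℕ} {W : Type u} [TopologicalSpace W] [T2Space W] [SecondCountableTopology W]
  [CompactSpace W] [ChartedSpace (EuclideanHalfSpace (n + 1)) W] [IsManifold (𝓡∂ (n + 1)) ∞ W]
  {g : W → ℝ} {ξ : Π x : W, TangentSpace (𝓡∂ (n + 1)) x} (B : BasinSetting g ξ)

/-! ### The small level sphere -/

/-- The level `sphR` lies in `(g p₀, hi)`. [folklore] -/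
theorem sphR_mem_Ioo : B.sphR ∈ Ioo (g B.p₀) B.hi :=
  ⟨by unfold BasinSetting.sphR; nlinarith [B.rad_pos], B.sphR_lt_sph.trans (B.sph_lt_L.trans B.L_lt_hi)⟩

/-- `sphR ≤ sph`. [folklore] -/
theorem sphR_le_sph : B.sphR ≤ B.sph := B.sphR_lt_sph.le

/-- The level `sphR` lies in the open slab. [folklore] -/
theorem sphR_mem_Ioo_lo : B.sphR ∈ Ioo B.lo B.hi := B.Ioo_subset_Ioo_lo B.sphR_mem_Ioo

/-- A point of level `≤ sph` has chart vector of norm `rad` iff its level is `sphR`. [folklore] -/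
theorem norm_toChart_eq_rad_iff {x : W} (hx : g x ≤ B.sph) : ‖B.toChart x‖ = B.rad ↔ g x = B.sphR := by
  have h := B.norm_toChart_sq hx
  unfold sphR
  constructor
  · intro h1; rw [h1] at h; linarith
  · intro h1
    have h2 : ‖B.toChart x‖ ^ 2 = B.rad ^ 2 := by rw [h, h1]; ring
    have := B.rad_pos
    nlinarith [norm_nonneg (B.toChart x), sq_nonneg (‖B.toChart x‖ - B.rad), sq_nonneg (‖B.toChart x‖ + B.rad)]

/-- `ofChart v` lies on the level sphere iff `‖v‖ = rad` (`‖v‖ ≤ r₀`). [folklore] -/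
theorem apply_ofChart_eq_sphR_iff {v : EuclideanSpace ℝ (Fin (n + 1))} (hv : ‖v‖ ≤ B.r₀) :
    g (B.ofChart v) = B.sphR ↔ ‖v‖ = B.rad := by
  rw [B.apply_ofChart hv]; unfold sphR
  constructor
  · intro h
    have h2 : ‖v‖ ^ 2 = B.rad ^ 2 := by linarith
    have := B.rad_pos
    nlinarith [norm_nonneg v, sq_nonneg (‖v‖ - B.rad), sq_nonneg (‖v‖ + B.rad)]
  · intro h; rw [h]

/-- Vectors of norm `rad` are shorter than `r₀`. [folklore] -/
theorem norm_lt_r₀_of_eq_rad {v : EuclideanSpace ℝ (Fin (n + 1))} (hv : ‖v‖ = B.rad) : ‖v‖ < B.r₀ := by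
  rw [hv]; exact B.rad_lt_r₀

/-! ### The planarisation -/

/-- **The domain of the planarisation**: boundary points whose trajectory crosses the small level
sphere (equivalently, off the traces, `mem_planarDom_iff`). [folklore] -/
def planarDom : Set ((𝓡∂ (n + 1)).boundary W) := {y | Hits B.θ g B.sphR (B.push (y : W))}

/-- **The low point** of a boundary point: the point of its trajectory on the small level
sphere. [cite: MilnorHCobordism1965, Thm. 4.1 (PDF p. 22)] -/
def low (y : (𝓡∂ (n + 1)).boundary W) : W := levelProj B.θ g B.sphR (B.push (y : W))

/-- **The planarisation**: the low point read in the radial chart at `p₀` (a vector of norm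
`rad`; junk off the domain). [cite: MilnorHCobordism1965, Def. 3.9, Thm. 4.1] -/
def planar (y : (𝓡∂ (n + 1)).boundary W) : EuclideanSpace ℝ (Fin (n + 1)) := B.toChart (B.low y)

variable {B}

/-- `mem_planarDom_iff_hits`. [folklore] -/
theorem mem_planarDom_iff_hits {y : (𝓡∂ (n + 1)).boundary W} : y ∈ B.planarDom ↔ Hits B.θ g B.sphR (B.push (y : W)) := Iff.rfl

/-- **The domain of the planarisation is the complement of the traces.** [cite: MilnorHCobordism1965, Def. 3.9, Thm. 4.1] -/
theorem mem_planarDom_iff {y : (𝓡∂ (n + 1)).boundary W} : y ∈ B.planarDom ↔ y ∉ B.traces := by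
  rw [mem_planarDom_iff_hits, ← coe_mem_basin_iff, mem_basin_iff, B.coe_mem_unstableSet_iff]
  constructor
  · -- a trajectory through the small level sphere comes from `p₀`
    rintro ⟨t, ht⟩
    have h1 : B.θ (t, B.push (y : W)) ∈ B.basin := B.mem_basin_of_apply_lt_sph (by rw [ht]; exact B.sphR_lt_sph)
    exact (B.θ_mem_basin_iff (by rw [B.apply_push_coe]; exact B.L_lt_hi.le)
      (by rw [ht]; exact (B.sphR_lt_sph.trans (B.sph_lt_L.trans B.L_lt_hi)).le)).1 h1
  · intro h
    exact B.hits_of_mem_basin_of_apply_eq_L h (B.apply_push_coe y) B.sphR_mem_Ioo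

/-- The domain of the planarisation is open. [folklore] -/
theorem isOpen_planarDom : IsOpen B.planarDom := by
  have h : B.planarDom = B.tracesᶜ := by ext y; rw [mem_planarDom_iff]; rfl
  rw [h]; exact B.isClosed_traces.isOpen_compl

/-- The low point lies on the small level sphere. [folklore] -/
theorem apply_low {y : (𝓡∂ (n + 1)).boundary W} (hy : y ∈ B.planarDom) : g (B.low y) = B.sphR := B.apply_levelProj hy

/-- The low point lies in the chart domain. [folklore] -/
theorem low_mem_source {y : (𝓡∂ (n + 1)).boundary W} (hy : y ∈ B.planarDom) : B.low y ∈ B.φ.source :=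
  B.mem_source_of_apply_le (by rw [apply_low hy]; exact B.sphR_le_sph)

/-- **The planarisation has norm `rad`.** [folklore] -/
theorem norm_planar {y : (𝓡∂ (n + 1)).boundary W} (hy : y ∈ B.planarDom) : ‖B.planar y‖ = B.rad :=
  (B.norm_toChart_eq_rad_iff (by rw [apply_low hy]; exact B.sphR_le_sph)).2 (apply_low hy)

/-- The chart point of the planarisation is the low point. [folklore] -/
theorem ofChart_planar {y : (𝓡∂ (n + 1)).boundary W} (hy : y ∈ B.planarDom) : B.ofChart (B.planar y) = B.low y :=
  B.ofChart_toChart (low_mem_source hy)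

/-- The top of the low point is the push. [folklore] -/
theorem top_low (y : (𝓡∂ (n + 1)).boundary W) : B.top (B.low y) = B.push (y : W) := B.top_levelProj (B.apply_push_coe y) _

variable [Nonempty (BoundaryManifold.boundaryData n W).carrier]

variable (B) in
/-- **The inverse planarisation**: the boundary point of the trajectory through the chart point
of `v`. [cite: MilnorHCobordism1965, Def. 3.9, Thm. 4.1] -/
def planarInv (v : EuclideanSpace ℝ (Fin (n + 1))) : (𝓡∂ (n + 1)).boundary W := B.bret (B.top (B.ofChart v))

/-- **`planarInv ∘ planar = id` on the domain.** [folklore] -/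
theorem planarInv_planar {y : (𝓡∂ (n + 1)).boundary W} (hy : y ∈ B.planarDom) : B.planarInv (B.planar y) = y := by
  rw [planarInv, ofChart_planar hy, top_low, B.bret_push_coe]

/-- **The planarisation is injective on its domain.** [folklore] -/
theorem planar_injOn : InjOn B.planar B.planarDom := fun y hy y' hy' h => by
  rw [← planarInv_planar hy, ← planarInv_planar hy', h]

/-- **`planar ∘ planarInv = id`** at the vectors of norm `rad` whose ray reaches `L`. [folklore] -/
theorem planar_planarInv {v : EuclideanSpace ℝ (Fin (n + 1))} (hv : ‖v‖ = B.rad) (hhit : Hits B.θ g B.L (B.ofChart v)) :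
    B.planar (B.planarInv v) = v ∧ B.planarInv v ∈ B.planarDom := by
  have hvr : ‖v‖ < B.r₀ := B.norm_lt_r₀_of_eq_rad hv
  set x := B.ofChart v with hx
  have hgx : g x = B.sphR := (B.apply_ofChart_eq_sphR_iff hvr.le).2 hv
  have hxI : g x ∈ Ioo (g B.p₀) B.hi := by rw [hgx]; exact B.sphR_mem_Ioo
  have hL : g (B.top x) = B.L := B.apply_top hhit
  have hpush : B.push (B.bret (B.top x) : W) = B.top x := by
    rw [B.coe_bret (by rw [hL]; exact B.one_sub_a'_lt_L.le), B.push_ret_of_apply_eq_L hL]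
  have hlow : B.low (B.planarInv v) = x := by
    rw [low, planarInv, hpush, ← hgx]; exact B.levelProj_top_self hhit hxI
  refine ⟨?_, ?_⟩
  · rw [planar, hlow, hx, B.toChart_ofChart hvr.le]
  · rw [mem_planarDom_iff_hits, planarInv, hpush, B.top_def]
    exact (B.hits_θ_iff _ x _).2 ⟨0, by rw [B.θ_zero]; exact hgx⟩

/-! ### Smoothness -/

omit [Nonempty (BoundaryManifold.boundaryData n W).carrier] in
/-- **The low point is smooth on the domain.** [cite: MilnorHCobordism1965, proof of Thm. 5.4, Assertion 4 (PDF p. 29)] -/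
theorem contMDiffAt_low {y : (𝓡∂ (n + 1)).boundary W} (hy : y ∈ B.planarDom) :
    ContMDiffAt (𝓡 n) (𝓡∂ (n + 1)) ∞ B.low y := by
  have h1 : ContMDiffAt (𝓡 n) (𝓡∂ (n + 1)) ∞ (fun y : (𝓡∂ (n + 1)).boundary W => B.push (y : W)) y :=
    B.contMDiff_push.contMDiffAt.comp y
      (BoundaryManifold.isSmoothEmbedding_subtype_val (n := n) (W := W)).contMDiff.contMDiffAt
  have h2 : ContMDiffAt (𝓡∂ (n + 1)) (𝓡∂ (n + 1)) ∞ (levelProj B.θ g B.sphR) (B.push (y : W)) :=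
    B.contMDiffAt_levelProj (B.apply_mem_slab (by rw [B.apply_push_coe]; exact B.L_lt_hi))
      (B.not_isMCriticalPt_of_eq_L (B.apply_push_coe y)) B.sphR_mem_Ioo_lo hy
  exact h2.comp y h1

omit [Nonempty (BoundaryManifold.boundaryData n W).carrier] in
/-- **The planarisation is smooth on the domain.** [folklore] -/
theorem contMDiffAt_planar {y : (𝓡∂ (n + 1)).boundary W} (hy : y ∈ B.planarDom) :
    ContMDiffAt (𝓡 n) 𝓘(ℝ, EuclideanSpace ℝ (Fin (n + 1))) ∞ B.planar y :=
  (B.contMDiffAt_toChart (low_mem_source hy)).comp y (contMDiffAt_low hy)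

/-- **The inverse planarisation is smooth** at the vectors of norm `< r₀` whose ray reaches `L`. [folklore] -/
theorem contMDiffAt_planarInv {v : EuclideanSpace ℝ (Fin (n + 1))} (hv : ‖v‖ < B.r₀) (hhit : Hits B.θ g B.L (B.ofChart v)) :
    ContMDiffAt 𝓘(ℝ, EuclideanSpace ℝ (Fin (n + 1))) (𝓡 n) ∞ B.planarInv v := by
  have hlt : g (B.ofChart v) < 1 := (B.apply_ofChart_lt_sph hv).trans (B.sph_lt_L.trans (B.L_lt_hi.trans B.hi_lt_one))
  have h1 : ContMDiffAt 𝓘(ℝ, EuclideanSpace ℝ (Fin (n + 1))) (𝓡∂ (n + 1)) ∞ (fun v => B.top (B.ofChart v)) v :=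
    (B.contMDiffAt_top hlt hhit).comp v (B.contMDiffAt_ofChart hv)
  exact (B.contMDiffAt_bret (B.depth_lt_of_apply_eq_L (B.apply_top hhit))).comp v h1

end BasinSetting

end Literature.Topology.FourManifolds
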